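import Literature.MathematicalPhysics.QuantumFieldTheory.Balaban1983to89.Beta.AveragingHessianKernels

/-!
# `Balaban1983to89.Beta.AveragingWardJets` — the SECOND-ORDER GAUGE WARD IDENTITIES of Bałaban's one-step covariant
# averaging (15) at the trivial background `U = 1`, LETTER LEVEL: the generic skew pairing sum `skew β`, the PATH WARD
# LEMMA along node 5's contours, the exact-form identities of node 7a's `hessU` / `vhU` (algebra flavour, (W-H), (W-V))
# and the backward-divergence = CONTACT-TERM laws of node 7a's integer kernels `hessCount` / `vhCount` (kernel flavour,
# (K-H), (K-V)), v1

HONEST FRAMING (page 1, mandatory).  This leaf belongs to the β sub-cell of the Bałaban audit, whose END STATEMENT is: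
discharging the one-loop hypothesis `FlowStep.BetaPertH` (read at END-STATEMENT grade, RULING (R6)) makes Bałaban's
ultraviolet stability theorem for 4-d lattice Yang–Mills ([Balaban1989LargeFieldII], Thm. 1 p. 355 (B16))
UNCONDITIONAL inside this package — a real constructive-QFT result; it is NOT the continuum limit and NOT the Clay
problem.  Gloss 2: EVERYTHING below is kernel-proved [folklore] algebra of finite letter lists and finite sums on `ℤ^d`
(plus three one-line real-number corollaries); NOTHING is cited as a fact.  [Balaban1985Averaging] (= B7, CMP 98 (1985)
17–51) and [Balaban1985BackgroundPropagators] (= B9, CMP 99 (1985) 389–434) are quoted only to say WHICH objects are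
being typed; the manuscripts under audit are not citable for their disputed steps and no programme-internal claim enters.

ABSOLUTE RULE (cell charter, verbatim): «No internally-minted statement may enter as a cited fact. Every hypothesis is
either kernel-proved in this package or a verbatim quotation of a PUBLISHED theorem with page reference. The
manuscript(s) under audit are NOT citable for their own disputed steps — they are the thing under adjudication;
programme-internal (2001/route/tribunal) claims are never citable.»  Accordingly NO declaration below is a
`def … : Prop` carrying a citation and no hypothesis of any theorem is a printed statement: every declaration is
[folklore]; the quotations are object LOCATORS only.

THE PRINTED OBJECTS (locators, verbatim, exactly those re-read as page images for node 7a `Beta.AveragingHessianKernels`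
(header there; B7 pp.19–20, journal page = PDF page + 16; B9 pp.392–393, journal page = PDF page + 388) and node 5
`Beta.AveragingContours` (contours), used here BY NAME):
* B7 p.19 (11) «(Ū^u)(y, y′) = u(y)Ū(y, y′)u^{−1}(y′), or Ū^u = (Ū)^u.» — the GAUGE COVARIANCE of the averaging, the
  printed statement whose second-order infinitesimal shadow at `U = 1` is the subject of this module;
  (14) «Ā_c = Σ_{x∈B(c_−)} L^{−(d+1)}(A(Γ_{c_−,x}) + A([x, x(c)]) + A(Γ_{x(c),c_+}))», «… an oriented contour with c_− as
  an initial point and c_+ as a final point. We denote it by Γ_{c,x}.», (15) «Ū_c = exp[i Σ_{x∈B(c_−)} L^{−d} (1/i)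
  log U(Γ_{c,x})U(c)^{−1}] U(c).»;
* B9 p.392 (3.12) «A^η(exp iηAU) = A^η(U) + ⟨A, J⟩ + ½⟨A, ΔA⟩ + ⋯» (the fluctuation multiplies the background on the
  LEFT: the PRODUCT CHART of node 7a's `vhU`).
Nothing printed is asserted.  In particular this module does NOT prove that its identities are the second `s∂_s`-jets
of the printed covariance (11) along `u = e^{sλ}`: the identification of node 7a's letter functionals with jets of local
logs of `Φ_b : U ↦ Ū_b` is node 7b `Beta.AveragingHessianJets` (THEOREMS P/A/B/H there, cited BY NAME, not restated),
and the BCH reading below is an informal gloss.  What is PROVED here is a family of EXACT IDENTITIES between explicitly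
defined letter functionals of node 5 / node 7a when one of the two one-forms is EXACT, `X = dλ := grad λ`
(node 5: `grad λ κ x = λ(x + e_κ) − λ(x)`), valid for every `λ : ℤ^d → 𝔸` and every one-form, over any ring (algebra
flavour) and over `ℤ` at indicator forms (kernel flavour).

THE CONSUMER.  RULING (R26) item P6c / (R28-2): the an1-owed instance «averaging jets: background-gauge covariance of
`affAvg` at SECOND order» of the β cell's Ward family ((W1)/(W2) of an2's `Beta.KernelWard` one order up; an2 states the
schema (W1′)/(W2′) on its `JetData` in the `JcRec` leaf).  (R28-3): P6c is a HYPOTHESIS of socket/END theorems only; this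
leaf proves unconditional letter identities and assumes nothing.  The transcription of §4–§5 into an2's (W1′)/(W2′)
schema is NOT in this module (it waits for that schema to land and will cite the theorems below BY NAME).

WHAT IS PROVED (all [folklore], sorry-free; `c₋ := L·y`, `c₊ := L·y + L·e_μ` the endpoints of the fine image `c` of the
coarse bond `b = (μ, y)`; `Z := linAvg` = the unnormalised letter sum of (14), node 5; `X(c) := (segUp X (L•y) μ L).sum`):
§1 THE SKEW PAIRING SUM `skew β ℓ = Σ_{i<j} (β aᵢ bⱼ − β aⱼ bᵢ)` of a biadditive `β : A →+ A →+ V` along a list of letter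
   pairs: node 7a's `cross` is `skew [·,·]` (`cross_eq_skew`, §4) and node 7a's `wedge` is `skew (·*·)` (`wedge_eq_skew`,
   §5); laws `skew_append` (block cross terms), `skew_rev` (odd), `skew_swap` (`= −skew β.flip`), additivity in the first
   letters (`skew_map_add_fst`), and the closure of the WARD SHAPE under `++` / `rev` (`skew_append_ward`, `skew_rev_ward`).
§2 THE PATH WARD LEMMA: for every contour combinator `P` of node 5 (`segUp`, `segDown`, `seg`, `axialAux`/`axial`,
   `gammaC`, `loopC`) running from `s_P` to `e_P`,
     `skew β (P (dλ, B)) = Σ_P midF β λ B − β (λ(s_P) + λ(e_P)) (Σ_P B)`,  `midF β λ B κ x := β (λ x + λ (x + e_κ)) (B κ x)`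
   (`skew_segUp_grad` … `skew_loopC_grad`; for the closed loop `s_P = e_P = c₋`).  Mechanism: `Σ_{i<j} (dλ)ᵢ` and
   `Σ_{j>i} (dλ)ⱼ` telescope to the gauge function at the path's ends and at the two ends of the `j`-th / `i`-th bond.
§3 THE GENERIC FUNCTIONALS `skewHess β X X′` (`= Σ_{x∈B(c₋)} skew(loop_x) + (β (Z X) (X′(c)) − β (X(c)) (Z X′)) +
   L^d • skew(c)`) and `skewVH β X X′` (`= L^d • skewHess + L^d • Z (ptF β X X′) − β (Z X) (Z X′)`), of which `hessU`,
   `vhU`, `hessCount`, `vhCount` are instances (§4, §5); BI-ADDITIVITY in each slot (`skewHess_add_left/right`,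
   `_sub_`, `_sum_`, same for `skewVH`), SLOT EXCHANGE `skewHess β X′ X = −skewHess β.flip X X′` (`skewHess_swap`), and
   THE FOUR WARD IDENTITIES
     `skewHess β (dλ) B = Z (midF β λ B) − β (λ c₋ + λ c₊) (Z B)`                       (`skewHess_grad_left`),
     `skewHess β X (dλ) = −(Z (midF β.flip λ X) − β.flip (λ c₋ + λ c₊) (Z X))`          (`skewHess_grad_right`),
     `skewVH β (dλ) B  = 2L^d • (Z (endF β λ B) − β (λ c₊) (Z B))`, `endF β λ B κ x := β (λ (x + e_κ)) (B κ x)` (`skewVH_grad_left`),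
     `skewVH β X (dλ)  = 2L^d • (β (Z X) (λ c₋) − Z (iniF β X λ))`, `iniF β X λ κ x := β (X κ x) (λ x)`   (`skewVH_grad_right`).
   (In the first: the letters of `B` along `c` CANCEL by node 5's `linAvg_grad`; in the third/fourth: `midF + ptF(dλ, ·)
   = 2•endF` resp. `ptF(·, dλ) = midF.flip − 2•iniF` pointwise.)
§4 ALGEBRA FLAVOUR (`𝔸` any ring, `β = [·,·] =: commBi`; bridges `hessU_eq_skewHess`, `vhU_eq_skewVH`):
   (W-H1) `hessU (dλ) B = Z [λ(·) + λ(·+e), B] − [λ c₋ + λ c₊, Z B]` (`hessU_grad_left`; (W-H2) `hessU_grad_right` by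
   node 7a `hessU_symm`); (W-V1) `vhU (dλ) B = 2L^d • (Z [λ(·+e), B] − [λ c₊, Z B])` (`vhU_grad_left`);
   (W-V2) `vhU W (dλ) = 2L^d • (Z [λ(·), W] − [λ c₋, Z W])` (`vhU_grad_right`).
§5 KERNEL FLAVOUR (`β = (·*·)` on `ℤ`; bridges `hessCount_eq_skewHess`, `vhCount_eq_skewVH`; the pure-gauge background
   variation at the fine site `z` is `d(δ_z) = Σ_κ (δ_{(κ, z−e_κ)} − δ_{(κ,z)})`, `grad_siteδ` — the backward divergence in
   the bond's base point, the convention of an2's `KernelWard.divV`): with `f′₋ := f′.2`, `f′₊ := f′.2 + e_{f′.1}`,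
   (K-H)  `Σ_κ (hessCount (κ, z−e_κ) f′ − hessCount (κ, z) f′) = ([f′₋ = z] + [f′₊ = z] − [c₋ = z] − [c₊ = z]) · linCount f′`
          (`hessCount_div_left`; second bond `hessCount_div_right` by node 7a `hessCount_swap`),
   (K-V1) `Σ_κ (vhCount (κ, z−e_κ) f′ − vhCount (κ, z) f′) = 2L^d · ([f′₊ = z] − [c₊ = z]) · linCount f′` (`vhCount_div_left`),
   (K-V2) `Σ_κ (vhCount f (κ, z−e_κ) − vhCount f (κ, z)) = 2L^d · ([c₋ = z] − [f₋ = z]) · linCount f`   (`vhCount_div_right`),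
   and the same for node 7a's real kernels `h_b = hessKer`, `m_b = vhKer`, `q¹_b = linKer` (`hessKer_div_left`,
   `vhKer_div_left/right`, `1 ≤ L`).  So NEITHER second-order kernel is transversal: the divergence is an explicit
   CONTACT TERM — the first-jet kernel weighted by the incidence of `z` with the endpoints of the other bond and of `c`
   (the letter-level analogue, one order up, of the right-hand sides `A ∘ X − X ∘ A`, `X ∘ V − V ∘ X` of an2's (W1)/(W2)).
§6 DECIDED TOYS (`d = 1`, `L = 2`): instances of (K-H), (K-V1), (K-V2) by `decide` against node 7a's §11 tables —
   including the SIGN of (K-V2) (the kernel is the coefficient of `[W_f, B_{f′}]`, fluctuation letter FIRST).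

INFORMAL GLOSS (not proved, not used): with `u = e^{sλ}` the bond letters of `U^u` at `U = e^{tB}` are
`e^{sλ_x} e^{tB_κ(x)} e^{−sλ_{x+e_κ}}`, whose `st`-term by BCH is `½[λ_x + λ_{x+e_κ}, B_κ(x)]` (`midF/2`), while the
coarse side of (11) contributes `½[λ(c₋) + λ(c₊), ·]` acting on the first jet: (W-H1) is the shape this predicts for the
polarised second jet of `log Φ_b` (node 7b THEOREM H), and (W-V1)/(W-V2) the shapes in the product chart (3.12)
(node 7b THEOREM B), where only the forward (resp. initial) bond endpoints and only `c₊` (resp. `c₋`) survive.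

WHAT IS NOT PROVED / NOT CLAIMED: nothing printed (B7 (11) in particular is NOT asserted, at any order); no statement
about `Φ_b` or its logarithms (node 7b's business, cited by name only); no fine-translation covariance (only node 7a's
block law exists); not the P6c instance in an2's `JetData` schema (W1′)/(W2′) (not yet in the tree); not (R1), not any
(K1·) binding, not `BetaPertH`.  Value = typed [folklore] letter algebra that the P6c transcription can cite by name.

Provenance: cell pub-balaban, β sub-cell, lineage an1, gen 12 (2026-08-19), node 8 of the an1 plan; imports node 7a
only (node 7b is cited by name in prose).  Sites are typed `(Fin d → ℤ)` throughout.
-/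

namespace Literature.MathematicalPhysics.QuantumFieldTheory.Balaban1983to89.Beta.AveragingWardJets

open Finset
open Literature.MathematicalPhysics.QuantumFieldTheory.Balaban1983to89.Beta.AffineAveraging
open Literature.MathematicalPhysics.QuantumFieldTheory.Balaban1983to89.Beta.AveragingContours
open Literature.MathematicalPhysics.QuantumFieldTheory.Balaban1983to89.Beta.TransportedContourVariables
open Literature.MathematicalPhysics.QuantumFieldTheory.Balaban1983to89.Beta.AveragingHessianKernels

/-! ## §1 The skew pairing sum of a biadditive pairing along a list of letter pairs -/

section Skew

variable {A V : Type*} [AddCommGroup A] [AddCommGroup V] (β : A →+ A →+ V)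

/-- [folklore] THE SKEW PAIRING SUM of a biadditive pairing `β` along a list of letter pairs
`[(a₁,b₁),…,(aₙ,bₙ)]`: `skew β l = Σ_{i<j} (β aᵢ bⱼ − β aⱼ bᵢ)`.  For `β = [·,·]` this is node 7a's `cross`
(`cross_eq_skew`), for `β = (·*·)` on a commutative ring node 7a's `wedge` (`wedge_eq_skew`). -/
def skew : List (A × A) → V
  | [] => 0
  | p :: l => skew l + (β p.1 (fl l).sum - β (bg l).sum p.2)

/-- [folklore] `skew β [] = 0`. -/
@[simp] theorem skew_nil : skew β ([] : List (A × A)) = 0 := rfl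

/-- [folklore] The recursion of `skew`. -/
@[simp] theorem skew_cons (p : A × A) (l : List (A × A)) :
    skew β (p :: l) = skew β l + (β p.1 (fl l).sum - β (bg l).sum p.2) := rfl

/-- [folklore] Concatenation law of `skew`: the cross terms of the two blocks. -/
theorem skew_append (l₁ l₂ : List (A × A)) :
    skew β (l₁ ++ l₂) = skew β l₁ + skew β l₂ + (β (bg l₁).sum (fl l₂).sum - β (bg l₂).sum (fl l₁).sum) := by
  induction l₁ with
  | nil => simp
  | cons p l ih =>
    simp only [List.cons_append, skew_cons, ih, bg_append, fl_append, List.sum_append, bg_cons, fl_cons,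
      List.sum_cons, map_add, AddMonoidHom.add_apply]
    abel

/-- [folklore] First letters of a reversed pair list. -/
theorem bg_rev (l : List (A × A)) : bg (rev l) = rev (bg l) := by
  simp [bg, rev, List.map_reverse, List.map_map, Function.comp_def]

/-- [folklore] Second letters of a reversed pair list. -/
theorem fl_rev (l : List (A × A)) : fl (rev l) = rev (fl l) := by
  simp [fl, rev, List.map_reverse, List.map_map, Function.comp_def]

/-- [folklore] `skew` is ODD under contour reversal (letters negated, order reversed). -/
theorem skew_rev (l : List (A × A)) : skew β (rev l) = -skew β l := by
  induction l with
  | nil => simp [rev]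
  | cons p l ih =>
    have h : rev (p :: l) = rev l ++ [-p] := by simp [rev]
    rw [h, skew_append, ih]
    simp only [skew_cons, skew_nil, bg_rev, fl_rev, rev_sum, fl_nil, bg_nil, List.sum_nil, fl_cons, bg_cons,
      List.sum_cons, Prod.fst_neg, Prod.snd_neg, map_zero, map_neg, AddMonoidHom.zero_apply, AddMonoidHom.neg_apply,
      add_zero, neg_neg]
    abel

/-- [folklore] `skew` under swapping the two letters of every pair: `skew β (swap l) = − skew β.flip l`. -/
theorem skew_swap (l : List (A × A)) : skew β (l.map Prod.swap) = -skew β.flip l := by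
  induction l with
  | nil => simp
  | cons p l ih =>
    have hb : bg (l.map Prod.swap) = fl l := by simp [bg, fl]
    have hf : fl (l.map Prod.swap) = bg l := by simp [bg, fl]
    rw [List.map_cons, skew_cons, skew_cons, ih, hb, hf, Prod.fst_swap, Prod.snd_swap, AddMonoidHom.flip_apply,
      AddMonoidHom.flip_apply]
    abel

/-- [folklore] THE TELESCOPING STEP UNDER CONCATENATION.  If along `l₁` (from `s` to `m`) and `l₂` (from `m` to `e`)
the first letters telescope (`Σ bg = λ_end − λ_start`) and `skew` has the Ward shape `M − β (λ_start + λ_end) (Σ fl)`,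
then the same holds along `l₁ ++ l₂` (from `s` to `e`) with `M = M₁ + M₂`. -/
theorem skew_append_ward {l₁ l₂ : List (A × A)} {ls lm le : A} {M₁ M₂ : V}
    (h₁ : skew β l₁ = M₁ - β (ls + lm) (fl l₁).sum) (hb₁ : (bg l₁).sum = lm - ls)
    (h₂ : skew β l₂ = M₂ - β (lm + le) (fl l₂).sum) (hb₂ : (bg l₂).sum = le - lm) :
    skew β (l₁ ++ l₂) = (M₁ + M₂) - β (ls + le) (fl (l₁ ++ l₂)).sum := by
  rw [skew_append, h₁, h₂, hb₁, hb₂, fl_append, List.sum_append]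
  simp only [map_add, map_sub, AddMonoidHom.add_apply, AddMonoidHom.sub_apply]
  abel

/-- [folklore] THE TELESCOPING STEP UNDER REVERSAL: the Ward shape from `s` to `e` becomes the Ward shape from `e`
to `s` with `M ↦ −M`. -/
theorem skew_rev_ward {l : List (A × A)} {ls le : A} {M : V} (h : skew β l = M - β (ls + le) (fl l).sum) :
    skew β (rev l) = (-M) - β (le + ls) (fl (rev l)).sum := by
  rw [skew_rev, h, fl_rev, rev_sum, map_neg, add_comm le ls]
  abel

/-- [folklore] ADDITIVITY OF `skew` IN THE FIRST LETTERS along aligned lists: a list of data pairs `(pᵢ, qᵢ)` read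
through the letters `(u pᵢ + v pᵢ, r qᵢ)` versus through `(u pᵢ, r qᵢ)` and `(v pᵢ, r qᵢ)` (any maps `u v r`; the
second letters are shared). -/
theorem skew_map_add_fst {P Q : Type*} (u v : P → A) (r : Q → A) (l : List (P × Q)) :
    skew β (l.map fun t => (u t.1 + v t.1, r t.2))
      = skew β (l.map fun t => (u t.1, r t.2)) + skew β (l.map fun t => (v t.1, r t.2)) := by
  induction l with
  | nil => simp
  | cons t l ih =>
    have hfl₀ : fl (l.map fun t => (u t.1 + v t.1, r t.2)) = l.map fun t => r t.2 := by
      simp [fl, List.map_map, Function.comp_def]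
    have hfl₁ : fl (l.map fun t => (u t.1, r t.2)) = l.map fun t => r t.2 := by
      simp [fl, List.map_map, Function.comp_def]
    have hfl₂ : fl (l.map fun t => (v t.1, r t.2)) = l.map fun t => r t.2 := by
      simp [fl, List.map_map, Function.comp_def]
    have hbg : (bg (l.map fun t => (u t.1 + v t.1, r t.2))).sum
        = (bg (l.map fun t => (u t.1, r t.2))).sum + (bg (l.map fun t => (v t.1, r t.2))).sum := by
      simp [bg, List.map_map, Function.comp_def, List.sum_map_add]
    simp only [List.map_cons, skew_cons, ih, hfl₀, hfl₁, hfl₂, hbg, map_add, AddMonoidHom.add_apply]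
    abel

end Skew

/-! ## §2 The PATH WARD LEMMA along node 5's contour combinators -/

section PathWard

variable {d : ℕ} {A V : Type*} [AddCommGroup A] [AddCommGroup V] (β : A →+ A →+ V)

/-- [folklore] The MID-POINT one-form of the Ward identity: the background letter `B_κ(x)` paired with the gauge
function at BOTH endpoints of its bond, `midF β λ B κ x = β (λ x + λ (x + e_κ)) (B κ x)`. -/
def midF (lam : (Fin d → ℤ) → A) (B : Form1 d A) : Form1 d V := fun κ x => β (lam x + lam (x + unitVec κ)) (B κ x)

/-- [folklore] Evaluation of `midF`. -/
@[simp] theorem midF_apply (lam : (Fin d → ℤ) → A) (B : Form1 d A) (κ : Fin d) (x : Fin d → ℤ) :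
    midF β lam B κ x = β (lam x + lam (x + unitVec κ)) (B κ x) := rfl

/-- [folklore] First letters of the pair form along a `−κ` segment. -/
theorem bg_segDown_pairForm (X B : Form1 d A) (z : Fin d → ℤ) (κ : Fin d) (n : ℕ) :
    bg (segDown (pairForm X B) z κ n) = segDown X z κ n := by
  have h := segDown_map (AddMonoidHom.fst A A) (pairForm X B) z κ n
  rw [mapForm_fst_pairForm] at h
  simpa [bg] using h

/-- [folklore] Second letters of the pair form along a `−κ` segment. -/
theorem fl_segDown_pairForm (X B : Form1 d A) (z : Fin d → ℤ) (κ : Fin d) (n : ℕ) :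
    fl (segDown (pairForm X B) z κ n) = segDown B z κ n := by
  have h := segDown_map (AddMonoidHom.snd A A) (pairForm X B) z κ n
  rw [mapForm_snd_pairForm] at h
  simpa [fl] using h

/-- [folklore] First letters of the pair form along a signed segment. -/
theorem bg_seg_pairForm (X B : Form1 d A) (z : Fin d → ℤ) (κ : Fin d) (n : ℤ) :
    bg (seg (pairForm X B) z κ n) = seg X z κ n := by
  have h := seg_map (AddMonoidHom.fst A A) (pairForm X B) z κ n
  rw [mapForm_fst_pairForm] at h
  simpa [bg] using h

/-- [folklore] Second letters of the pair form along a signed segment. -/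
theorem fl_seg_pairForm (X B : Form1 d A) (z : Fin d → ℤ) (κ : Fin d) (n : ℤ) :
    fl (seg (pairForm X B) z κ n) = seg B z κ n := by
  have h := seg_map (AddMonoidHom.snd A A) (pairForm X B) z κ n
  rw [mapForm_snd_pairForm] at h
  simpa [fl] using h

/-- [folklore] First letters of the pair form along a partial axial contour. -/
theorem bg_axialAux_pairForm (X B : Form1 d A) (y x : Fin d → ℤ) (m : ℕ) :
    bg (axialAux (pairForm X B) y x m) = axialAux X y x m := by
  have h := axialAux_map (AddMonoidHom.fst A A) (pairForm X B) y x m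
  rw [mapForm_fst_pairForm] at h
  simpa [bg] using h

/-- [folklore] Second letters of the pair form along a partial axial contour. -/
theorem fl_axialAux_pairForm (X B : Form1 d A) (y x : Fin d → ℤ) (m : ℕ) :
    fl (axialAux (pairForm X B) y x m) = axialAux B y x m := by
  have h := axialAux_map (AddMonoidHom.snd A A) (pairForm X B) y x m
  rw [mapForm_snd_pairForm] at h
  simpa [fl] using h

/-- [folklore] PATH WARD LEMMA, straight `+κ` segment from `z` to `z + n e_κ`:
`skew β (grad λ, B) = Σ midF − β (λ(start) + λ(end)) (Σ B)`. -/
theorem skew_segUp_grad (lam : (Fin d → ℤ) → A) (B : Form1 d A) (z : Fin d → ℤ) (κ : Fin d) (n : ℕ) :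
    skew β (segUp (pairForm (grad lam) B) z κ n)
      = (segUp (midF β lam B) z κ n).sum - β (lam z + lam (z + (n : ℤ) • unitVec κ)) (segUp B z κ n).sum := by
  induction n with
  | zero => simp
  | succ n ih =>
    simp only [segUp_succ, skew_append, ih, skew_cons, skew_nil, fl_nil, bg_nil, fl_cons, bg_cons, List.sum_nil,
      List.sum_cons, List.sum_append, bg_segUp_pairForm, fl_segUp_pairForm, segUp_sum_grad, pairForm_apply, grad,
      midF_apply, map_zero, AddMonoidHom.zero_apply, map_add, map_sub, AddMonoidHom.add_apply,
      AddMonoidHom.sub_apply, Nat.cast_succ, add_smul, one_smul, add_zero, sub_zero, add_assoc]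
    abel

/-- [folklore] PATH WARD LEMMA, straight `−κ` segment from `z` to `z − n e_κ`. -/
theorem skew_segDown_grad (lam : (Fin d → ℤ) → A) (B : Form1 d A) (z : Fin d → ℤ) (κ : Fin d) (n : ℕ) :
    skew β (segDown (pairForm (grad lam) B) z κ n)
      = (segDown (midF β lam B) z κ n).sum - β (lam z + lam (z - (n : ℤ) • unitVec κ)) (segDown B z κ n).sum := by
  induction n with
  | zero => simp
  | succ n ih =>
    have hz : z - ((n : ℤ) + 1) • unitVec κ + unitVec κ = z - (n : ℤ) • unitVec κ := by
      rw [add_smul, one_smul]; abel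
    simp only [segDown_succ, skew_append, ih, skew_cons, skew_nil, fl_nil, bg_nil, fl_cons, bg_cons, List.sum_nil,
      List.sum_cons, List.sum_append, bg_segDown_pairForm, fl_segDown_pairForm, segDown_sum_grad, pairForm_apply,
      Prod.neg_mk, grad, midF_apply, hz, map_zero, AddMonoidHom.zero_apply, map_add, map_sub, map_neg,
      AddMonoidHom.add_apply, AddMonoidHom.sub_apply, AddMonoidHom.neg_apply, Nat.cast_succ, add_zero, zero_add,
      zero_sub]
    abel

/-- [folklore] PATH WARD LEMMA, signed straight segment from `z` to `z + n e_κ`. -/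
theorem skew_seg_grad (lam : (Fin d → ℤ) → A) (B : Form1 d A) (z : Fin d → ℤ) (κ : Fin d) (n : ℤ) :
    skew β (seg (pairForm (grad lam) B) z κ n)
      = (seg (midF β lam B) z κ n).sum - β (lam z + lam (z + n • unitVec κ)) (seg B z κ n).sum := by
  unfold seg
  split_ifs with h
  · rw [skew_segUp_grad, Int.toNat_of_nonneg h]
  · rw [skew_segDown_grad]
    have hn : ((-n).toNat : ℤ) = -n := Int.toNat_of_nonneg (by omega)
    rw [hn, neg_smul, sub_neg_eq_add]

/-- [folklore] PATH WARD LEMMA, partial axial contour from `corner y x m` to `x`. -/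
theorem skew_axialAux_grad (lam : (Fin d → ℤ) → A) (B : Form1 d A) (y x : Fin d → ℤ) :
    ∀ m, m ≤ d → skew β (axialAux (pairForm (grad lam) B) y x m)
      = (axialAux (midF β lam B) y x m).sum - β (lam (corner y x m) + lam x) (axialAux B y x m).sum
  | 0, _ => by simp [axialAux]
  | m + 1, hm => by
    have h : m < d := by omega
    have ih := skew_axialAux_grad lam B y x m (by omega)
    simp only [axialAux, h, dif_pos, skew_append, ih, skew_seg_grad, List.sum_append, bg_seg_pairForm,
      fl_seg_pairForm, bg_axialAux_pairForm, fl_axialAux_pairForm, seg_sum_grad, axialAux_sum_grad lam y x m h.le,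
      corner_succ_add y x m h, map_add, map_sub, AddMonoidHom.add_apply, AddMonoidHom.sub_apply]
    abel

/-- [folklore] PATH WARD LEMMA along `Γ_{y,x}` (from `y` to `x`). -/
theorem skew_axial_grad (lam : (Fin d → ℤ) → A) (B : Form1 d A) (y x : Fin d → ℤ) :
    skew β (axial (pairForm (grad lam) B) y x)
      = (axial (midF β lam B) y x).sum - β (lam y + lam x) (axial B y x).sum := by
  rw [axial, axial, axial, skew_axialAux_grad β lam B y x d le_rfl, corner_d]

/-- [folklore] PATH WARD LEMMA along Bałaban's `Γ_{c,x}` (from `c₋ = L·y` to `c₊ = L·y + L·e_μ`). -/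
theorem skew_gammaC_grad (lam : (Fin d → ℤ) → A) (B : Form1 d A) (L : ℕ) (μ : Fin d) (y : Fin d → ℤ)
    (b : Fin d → ℕ) :
    skew β (gammaC (pairForm (grad lam) B) L μ y b)
      = (gammaC (midF β lam B) L μ y b).sum
        - β (lam ((L : ℤ) • y) + lam ((L : ℤ) • y + (L : ℤ) • unitVec μ)) (gammaC B L μ y b).sum := by
  simp only [gammaC, skew_append, skew_rev, skew_axial_grad, skew_segUp_grad, bg_append, fl_append, bg_rev, fl_rev,
    rev_sum, List.sum_append, bg_axial_pairForm, fl_axial_pairForm, bg_segUp_pairForm, fl_segUp_pairForm,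
    axial_sum_grad, segUp_sum_grad, map_add, map_sub, map_neg, AddMonoidHom.add_apply, AddMonoidHom.sub_apply,
    AddMonoidHom.neg_apply]
  abel

/-- [folklore] PATH WARD LEMMA along the closed loop `Γ_{c,x} ∪ (−c)` (from `c₋` back to `c₋`): the coefficient of
`Σ B` is `β` of TWICE the gauge function at the base point. -/
theorem skew_loopC_grad (lam : (Fin d → ℤ) → A) (B : Form1 d A) (L : ℕ) (μ : Fin d) (y : Fin d → ℤ)
    (b : Fin d → ℕ) :
    skew β (loopC (pairForm (grad lam) B) L μ y b)
      = (loopC (midF β lam B) L μ y b).sum - β (lam ((L : ℤ) • y) + lam ((L : ℤ) • y)) (loopC B L μ y b).sum := by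
  simp only [loopC, skew_append, skew_rev, skew_gammaC_grad, skew_segUp_grad, bg_rev, fl_rev,
    rev_sum, List.sum_append, bg_gammaC_pairForm, fl_gammaC_pairForm, bg_segUp_pairForm, fl_segUp_pairForm,
    gammaC_sum_grad, segUp_sum_grad, map_add, map_sub, map_neg, AddMonoidHom.add_apply, AddMonoidHom.sub_apply,
    AddMonoidHom.neg_apply]
  abel

end PathWard

/-! ## §3 The generic second-order functionals `skewHess β`, `skewVH β` and their Ward identities -/

section Functional

variable {d : ℕ} {A V : Type*} [AddCommGroup A] [AddCommGroup V] (β : A →+ A →+ V)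

/-- [folklore] The pointwise pairing one-form `ptF β X X′ κ x = β (X κ x) (X′ κ x)` (node 7a's `bw` for `β = [·,·]`). -/
def ptF (X X' : Form1 d A) : Form1 d V := fun κ x => β (X κ x) (X' κ x)

/-- [folklore] Evaluation of `ptF`. -/
@[simp] theorem ptF_apply (X X' : Form1 d A) (κ : Fin d) (x : Fin d → ℤ) : ptF β X X' κ x = β (X κ x) (X' κ x) := rfl

/-- [folklore] The FORWARD-ENDPOINT one-form `endF β λ B κ x = β (λ (x + e_κ)) (B κ x)`. -/
def endF (lam : (Fin d → ℤ) → A) (B : Form1 d A) : Form1 d V := fun κ x => β (lam (x + unitVec κ)) (B κ x)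

/-- [folklore] Evaluation of `endF`. -/
@[simp] theorem endF_apply (lam : (Fin d → ℤ) → A) (B : Form1 d A) (κ : Fin d) (x : Fin d → ℤ) :
    endF β lam B κ x = β (lam (x + unitVec κ)) (B κ x) := rfl

/-- [folklore] The INITIAL-ENDPOINT one-form `iniF β X λ κ x = β (X κ x) (λ x)` (first slot kept for the form). -/
def iniF (X : Form1 d A) (lam : (Fin d → ℤ) → A) : Form1 d V := fun κ x => β (X κ x) (lam x)

/-- [folklore] Evaluation of `iniF`. -/
@[simp] theorem iniF_apply (X : Form1 d A) (lam : (Fin d → ℤ) → A) (κ : Fin d) (x : Fin d → ℤ) :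
    iniF β X lam κ x = β (X κ x) (lam x) := rfl

/-- [folklore] THE GENERIC SECOND-ORDER FUNCTIONAL of a biadditive pairing `β` (node 7a's `hessU` is the instance
`β = [·,·]`, `hessU_eq_skewHess`; node 7a's integer kernel `hessCount` the instance `β = (·*·)` on `ℤ` at indicator forms,
`hessCount_eq_skewHess`): `Σ_{x ∈ B(c₋)} skew β (loop_x) + (β (Z X) (X′(c)) − β (X(c)) (Z X′)) + L^d • skew β (c)`,
`Z = linAvg` (node 5, (14) unnormalised), `X(c)` the letter sum along the straight coarse bond `c`. -/
def skewHess (X X' : Form1 d A) (L : ℕ) (μ : Fin d) (y : Fin d → ℤ) : V :=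
  (∑ b ∈ box d L, skew β (loopC (pairForm X X') L μ y b))
    + (β (linAvg X L μ y) (segUp X' ((L : ℤ) • y) μ L).sum - β (segUp X ((L : ℤ) • y) μ L).sum (linAvg X' L μ y))
    + ((L : ℤ) ^ d) • skew β (segUp (pairForm X X') ((L : ℤ) • y) μ L)

/-- [folklore] THE GENERIC PRODUCT-CHART FUNCTIONAL (node 7a's `vhU` is the instance `β = [·,·]`, `vhU_eq_skewVH`;
`vhCount` the instance `β = (·*·)` on `ℤ`, `vhCount_eq_skewVH`):
`L^d • skewHess β X X′ + L^d • Z (ptF β X X′) − β (Z X) (Z X′)`. -/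
def skewVH (X X' : Form1 d A) (L : ℕ) (μ : Fin d) (y : Fin d → ℤ) : V :=
  ((L : ℤ) ^ d) • skewHess β X X' L μ y + ((L : ℤ) ^ d) • linAvg (ptF β X X') L μ y
    - β (linAvg X L μ y) (linAvg X' L μ y)

/-- [folklore] `linAvg` is additive in the form (differences; node 5 `gammaC_sum_sub`). -/
theorem linAvg_subForm (X X' : Form1 d A) (L : ℕ) (μ : Fin d) (y : Fin d → ℤ) :
    linAvg (X - X') L μ y = linAvg X L μ y - linAvg X' L μ y := by
  simp only [linAvg, gammaC_sum_sub, Finset.sum_sub_distrib]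

/-- [folklore] `linAvg 0 = 0`. -/
theorem linAvg_zeroForm (L : ℕ) (μ : Fin d) (y : Fin d → ℤ) : linAvg (0 : Form1 d A) L μ y = 0 := by
  simpa using linAvg_subForm (0 : Form1 d A) 0 L μ y

/-- [folklore] `linAvg` is additive in the form (sums). -/
theorem linAvg_addForm (X X' : Form1 d A) (L : ℕ) (μ : Fin d) (y : Fin d → ℤ) :
    linAvg (X + X') L μ y = linAvg X L μ y + linAvg X' L μ y := by
  have h := linAvg_subForm (X + X') X' L μ y
  rw [add_sub_cancel_right] at h
  rw [h]; abel

/-- [folklore] The straight-segment letter sum is additive in the form (sums; node 5 `segUp_sum_sub`). -/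
theorem segUp_sum_addForm (X X' : Form1 d A) (z : Fin d → ℤ) (κ : Fin d) (n : ℕ) :
    (segUp (X + X') z κ n).sum = (segUp X z κ n).sum + (segUp X' z κ n).sum := by
  have h := segUp_sum_sub (X + X') X' z κ n
  rw [add_sub_cancel_right] at h
  rw [h]; abel

/-- [folklore] `Σ_{x ∈ B(c₋)} X(loop_x) = Z X − L^d • X(c)` over any additive group (node 7b's `sum_box_sum_loopC` is the
normed-ring instance; here with an integer scalar). -/
theorem sum_box_loopC_sum (X : Form1 d A) (L : ℕ) (μ : Fin d) (y : Fin d → ℤ) :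
    ∑ b ∈ box d L, (loopC X L μ y b).sum = linAvg X L μ y - ((L : ℤ) ^ d) • (segUp X ((L : ℤ) • y) μ L).sum := by
  have hcard : (box d L).card = L ^ d := by simp [AffineAveraging.box, Fintype.card_piFinset]
  simp only [loopC, List.sum_append, rev_sum, Finset.sum_add_distrib, Finset.sum_neg_distrib, Finset.sum_const,
    hcard, linAvg, ← natCast_zsmul, Nat.cast_pow]
  abel

/-- [folklore] ADDITIVITY of the loop `skew` in the first form. -/
theorem skew_loopC_add_left (X₁ X₂ X' : Form1 d A) (L : ℕ) (μ : Fin d) (y : Fin d → ℤ) (b : Fin d → ℕ) :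
    skew β (loopC (pairForm (X₁ + X₂) X') L μ y b)
      = skew β (loopC (pairForm X₁ X') L μ y b) + skew β (loopC (pairForm X₂ X') L μ y b) := by
  have e : ∀ w : A × A →+ A, pairForm (fun κ x => w (X₁ κ x, X₂ κ x)) X'
      = mapForm (w.prodMap (AddMonoidHom.fst A A)) (pairForm (pairForm X₁ X₂) (pairForm X' X')) := by
    intro w; funext κ x; simp
  have c : ∀ w : A × A →+ A,
      (loopC (pairForm (pairForm X₁ X₂) (pairForm X' X')) L μ y b).map ⇑(w.prodMap (AddMonoidHom.fst A A))
        = (loopC (pairForm (pairForm X₁ X₂) (pairForm X' X')) L μ y b).map fun t => (w t.1, t.2.1) := by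
    intro w; apply List.map_congr_left; intro t _; rfl
  have h₀ : pairForm (X₁ + X₂) X'
      = pairForm (fun κ x => (AddMonoidHom.fst A A + AddMonoidHom.snd A A) (X₁ κ x, X₂ κ x)) X' := by
    funext κ x; simp
  have h₁ : pairForm X₁ X' = pairForm (fun κ x => (AddMonoidHom.fst A A) (X₁ κ x, X₂ κ x)) X' := by
    funext κ x; simp
  have h₂ : pairForm X₂ X' = pairForm (fun κ x => (AddMonoidHom.snd A A) (X₁ κ x, X₂ κ x)) X' := by
    funext κ x; simp
  rw [h₀, h₁, h₂, e, e, e, ← loopC_map, ← loopC_map, ← loopC_map, c, c, c]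
  simpa using skew_map_add_fst β (fun q : A × A => q.1) (fun q : A × A => q.2) (fun q : A × A => q.1)
    (loopC (pairForm (pairForm X₁ X₂) (pairForm X' X')) L μ y b)

/-- [folklore] ADDITIVITY of the straight-segment `skew` in the first form. -/
theorem skew_segUp_add_left (X₁ X₂ X' : Form1 d A) (z : Fin d → ℤ) (κ : Fin d) (n : ℕ) :
    skew β (segUp (pairForm (X₁ + X₂) X') z κ n)
      = skew β (segUp (pairForm X₁ X') z κ n) + skew β (segUp (pairForm X₂ X') z κ n) := by
  have e : ∀ w : A × A →+ A, pairForm (fun κ x => w (X₁ κ x, X₂ κ x)) X'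
      = mapForm (w.prodMap (AddMonoidHom.fst A A)) (pairForm (pairForm X₁ X₂) (pairForm X' X')) := by
    intro w; funext κ x; simp
  have c : ∀ w : A × A →+ A,
      (segUp (pairForm (pairForm X₁ X₂) (pairForm X' X')) z κ n).map ⇑(w.prodMap (AddMonoidHom.fst A A))
        = (segUp (pairForm (pairForm X₁ X₂) (pairForm X' X')) z κ n).map fun t => (w t.1, t.2.1) := by
    intro w; apply List.map_congr_left; intro t _; rfl
  have h₀ : pairForm (X₁ + X₂) X'
      = pairForm (fun κ x => (AddMonoidHom.fst A A + AddMonoidHom.snd A A) (X₁ κ x, X₂ κ x)) X' := by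
    funext κ x; simp
  have h₁ : pairForm X₁ X' = pairForm (fun κ x => (AddMonoidHom.fst A A) (X₁ κ x, X₂ κ x)) X' := by
    funext κ x; simp
  have h₂ : pairForm X₂ X' = pairForm (fun κ x => (AddMonoidHom.snd A A) (X₁ κ x, X₂ κ x)) X' := by
    funext κ x; simp
  rw [h₀, h₁, h₂, e, e, e, ← segUp_map, ← segUp_map, ← segUp_map, c, c, c]
  simpa using skew_map_add_fst β (fun q : A × A => q.1) (fun q : A × A => q.2) (fun q : A × A => q.1)
    (segUp (pairForm (pairForm X₁ X₂) (pairForm X' X')) z κ n)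

/-- [folklore] `skewHess β` is ADDITIVE in the first form. -/
theorem skewHess_add_left (X₁ X₂ X' : Form1 d A) (L : ℕ) (μ : Fin d) (y : Fin d → ℤ) :
    skewHess β (X₁ + X₂) X' L μ y = skewHess β X₁ X' L μ y + skewHess β X₂ X' L μ y := by
  simp only [skewHess, skew_loopC_add_left, skew_segUp_add_left, Finset.sum_add_distrib, linAvg_addForm,
    segUp_sum_addForm, map_add, AddMonoidHom.add_apply, smul_add]
  abel

/-- [folklore] `skewHess β 0 X′ = 0`. -/
theorem skewHess_zero_left (X' : Form1 d A) (L : ℕ) (μ : Fin d) (y : Fin d → ℤ) : skewHess β 0 X' L μ y = 0 := by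
  have h := skewHess_add_left β 0 0 X' L μ y
  rw [add_zero] at h
  exact left_eq_add.mp h

/-- [folklore] `skewHess β` respects differences in the first form. -/
theorem skewHess_sub_left (X₁ X₂ X' : Form1 d A) (L : ℕ) (μ : Fin d) (y : Fin d → ℤ) :
    skewHess β (X₁ - X₂) X' L μ y = skewHess β X₁ X' L μ y - skewHess β X₂ X' L μ y := by
  have h := skewHess_add_left β (X₁ - X₂) X₂ X' L μ y
  rw [sub_add_cancel] at h
  rw [h]; abel

/-- [folklore] `skewHess β` respects finite sums in the first form. -/
theorem skewHess_sum_left {ι : Type*} (s : Finset ι) (X : ι → Form1 d A) (X' : Form1 d A) (L : ℕ) (μ : Fin d)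
    (y : Fin d → ℤ) : skewHess β (∑ i ∈ s, X i) X' L μ y = ∑ i ∈ s, skewHess β (X i) X' L μ y := by
  classical
  refine Finset.induction_on s ?_ ?_
  · simp [skewHess_zero_left]
  · intro i s hi ih
    rw [Finset.sum_insert hi, Finset.sum_insert hi, skewHess_add_left, ih]

/-- [folklore] SLOT EXCHANGE: `skewHess β X′ X = − skewHess β.flip X X′` (for `β = [·,·]`, `β.flip = −β`: node 7a's
`hessU_symm`; for a commutative product, `β.flip = β`: node 7a's `hessCount_swap`). -/
theorem skewHess_swap (X X' : Form1 d A) (L : ℕ) (μ : Fin d) (y : Fin d → ℤ) :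
    skewHess β X' X L μ y = -skewHess β.flip X X' L μ y := by
  have hp : pairForm X' X = mapForm (AddEquiv.prodComm : A × A ≃+ A × A).toAddMonoidHom (pairForm X X') := by
    funext κ x; rfl
  have hl : ∀ b, loopC (pairForm X' X) L μ y b = (loopC (pairForm X X') L μ y b).map Prod.swap := by
    intro b; rw [hp, ← loopC_map]; rfl
  have hs : segUp (pairForm X' X) ((L : ℤ) • y) μ L = (segUp (pairForm X X') ((L : ℤ) • y) μ L).map Prod.swap := by
    rw [hp, ← segUp_map]; rfl
  simp only [skewHess, hl, hs, skew_swap, Finset.sum_neg_distrib, AddMonoidHom.flip_apply, smul_neg]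
  abel

/-- [folklore] `skewHess β` is ADDITIVE in the second form. -/
theorem skewHess_add_right (X X'₁ X'₂ : Form1 d A) (L : ℕ) (μ : Fin d) (y : Fin d → ℤ) :
    skewHess β X (X'₁ + X'₂) L μ y = skewHess β X X'₁ L μ y + skewHess β X X'₂ L μ y := by
  rw [skewHess_swap β (X'₁ + X'₂) X, skewHess_swap β X'₁ X, skewHess_swap β X'₂ X, skewHess_add_left, neg_add]

/-- [folklore] `skewHess β` respects differences in the second form. -/
theorem skewHess_sub_right (X X'₁ X'₂ : Form1 d A) (L : ℕ) (μ : Fin d) (y : Fin d → ℤ) :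
    skewHess β X (X'₁ - X'₂) L μ y = skewHess β X X'₁ L μ y - skewHess β X X'₂ L μ y := by
  rw [skewHess_swap β (X'₁ - X'₂) X, skewHess_swap β X'₁ X, skewHess_swap β X'₂ X, skewHess_sub_left]
  abel

/-- [folklore] `skewHess β` respects finite sums in the second form. -/
theorem skewHess_sum_right {ι : Type*} (s : Finset ι) (X : Form1 d A) (X' : ι → Form1 d A) (L : ℕ) (μ : Fin d)
    (y : Fin d → ℤ) : skewHess β X (∑ i ∈ s, X' i) L μ y = ∑ i ∈ s, skewHess β X (X' i) L μ y := by
  rw [skewHess_swap β _ X, skewHess_sum_left, ← Finset.sum_neg_distrib]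
  refine Finset.sum_congr rfl fun i _ => ?_
  rw [skewHess_swap β (X' i) X]

/-- [folklore] `skewVH β` is ADDITIVE in the first form. -/
theorem skewVH_add_left (X₁ X₂ X' : Form1 d A) (L : ℕ) (μ : Fin d) (y : Fin d → ℤ) :
    skewVH β (X₁ + X₂) X' L μ y = skewVH β X₁ X' L μ y + skewVH β X₂ X' L μ y := by
  have hpt : ptF β (X₁ + X₂) X' = ptF β X₁ X' + ptF β X₂ X' := by
    funext κ x; simp [map_add, AddMonoidHom.add_apply]
  simp only [skewVH, skewHess_add_left, hpt, linAvg_addForm, map_add, AddMonoidHom.add_apply, smul_add]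
  abel

/-- [folklore] `skewVH β` respects differences in the first form. -/
theorem skewVH_sub_left (X₁ X₂ X' : Form1 d A) (L : ℕ) (μ : Fin d) (y : Fin d → ℤ) :
    skewVH β (X₁ - X₂) X' L μ y = skewVH β X₁ X' L μ y - skewVH β X₂ X' L μ y := by
  have h := skewVH_add_left β (X₁ - X₂) X₂ X' L μ y
  rw [sub_add_cancel] at h
  rw [h]; abel

/-- [folklore] `skewVH β 0 X′ = 0`. -/
theorem skewVH_zero_left (X' : Form1 d A) (L : ℕ) (μ : Fin d) (y : Fin d → ℤ) : skewVH β 0 X' L μ y = 0 := by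
  have h := skewVH_add_left β 0 0 X' L μ y
  rw [add_zero] at h
  exact left_eq_add.mp h

/-- [folklore] `skewVH β` respects finite sums in the first form. -/
theorem skewVH_sum_left {ι : Type*} (s : Finset ι) (X : ι → Form1 d A) (X' : Form1 d A) (L : ℕ) (μ : Fin d)
    (y : Fin d → ℤ) : skewVH β (∑ i ∈ s, X i) X' L μ y = ∑ i ∈ s, skewVH β (X i) X' L μ y := by
  classical
  refine Finset.induction_on s ?_ ?_
  · simp [skewVH_zero_left]
  · intro i s hi ih
    rw [Finset.sum_insert hi, Finset.sum_insert hi, skewVH_add_left, ih]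

/-- [folklore] `skewVH β` is ADDITIVE in the second form. -/
theorem skewVH_add_right (X X'₁ X'₂ : Form1 d A) (L : ℕ) (μ : Fin d) (y : Fin d → ℤ) :
    skewVH β X (X'₁ + X'₂) L μ y = skewVH β X X'₁ L μ y + skewVH β X X'₂ L μ y := by
  have hpt : ptF β X (X'₁ + X'₂) = ptF β X X'₁ + ptF β X X'₂ := by
    funext κ x; simp [map_add]
  simp only [skewVH, skewHess_add_right, hpt, linAvg_addForm, map_add, smul_add]
  abel

/-- [folklore] `skewVH β` respects differences in the second form. -/
theorem skewVH_sub_right (X X'₁ X'₂ : Form1 d A) (L : ℕ) (μ : Fin d) (y : Fin d → ℤ) :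
    skewVH β X (X'₁ - X'₂) L μ y = skewVH β X X'₁ L μ y - skewVH β X X'₂ L μ y := by
  have h := skewVH_add_right β X (X'₁ - X'₂) X'₂ L μ y
  rw [sub_add_cancel] at h
  rw [h]; abel

/-- [folklore] `skewVH β X 0 = 0`. -/
theorem skewVH_zero_right (X : Form1 d A) (L : ℕ) (μ : Fin d) (y : Fin d → ℤ) : skewVH β X 0 L μ y = 0 := by
  have h := skewVH_add_right β X 0 0 L μ y
  rw [add_zero] at h
  exact left_eq_add.mp h

/-- [folklore] `skewVH β` respects finite sums in the second form. -/
theorem skewVH_sum_right {ι : Type*} (s : Finset ι) (X : Form1 d A) (X' : ι → Form1 d A) (L : ℕ) (μ : Fin d)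
    (y : Fin d → ℤ) : skewVH β X (∑ i ∈ s, X' i) L μ y = ∑ i ∈ s, skewVH β X (X' i) L μ y := by
  classical
  refine Finset.induction_on s ?_ ?_
  · simp [skewVH_zero_right]
  · intro i s hi ih
    rw [Finset.sum_insert hi, Finset.sum_insert hi, skewVH_add_right, ih]

/-- [folklore] **THE SECOND-ORDER WARD IDENTITY, W-Hessian type, exact form in the FIRST slot.**  For every gauge
function `λ` on the fine lattice and every one-form `B`,
`skewHess β (grad λ) B = Z (midF β λ B) − β (λ(c₋) + λ(c₊)) (Z B)`, `c₋ = L·y`, `c₊ = L·y + L·e_μ`: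
the bond letters of `B` get paired with `λ` at both endpoints of their bond (`midF`), and the coarse endpoints of `b`
contribute the conjugation term.  (The letters of `B` along `c` CANCEL: `2L^d·β(λ₋)(B(c)) + β(Z dλ)(B(c)) −
L^d·β(λ₋ + λ₊)(B(c)) = 0` by node 5's `linAvg_grad`.) -/
theorem skewHess_grad_left (lam : (Fin d → ℤ) → A) (B : Form1 d A) (L : ℕ) (μ : Fin d) (y : Fin d → ℤ) :
    skewHess β (grad lam) B L μ y
      = linAvg (midF β lam B) L μ y
        - β (lam ((L : ℤ) • y) + lam ((L : ℤ) • y + (L : ℤ) • unitVec μ)) (linAvg B L μ y) := by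
  have hcard : (box d L).card = L ^ d := by simp [AffineAveraging.box, Fintype.card_piFinset]
  have hβsum : ∀ (c : A) (g : (Fin d → ℕ) → A),
      ∑ b ∈ box d L, β c (g b) = β c (∑ b ∈ box d L, g b) := fun c g => (map_sum (β c) g _).symm
  simp only [skewHess, skew_loopC_grad, skew_segUp_grad, Finset.sum_sub_distrib, Finset.sum_add_distrib, hβsum,
    sum_box_loopC_sum, linAvg_grad, hcard, segUp_sum_grad, map_add, map_sub, map_zsmul, AddMonoidHom.add_apply,
    AddMonoidHom.sub_apply, AddMonoidHom.zsmul_apply, smul_add, smul_sub, ← natCast_zsmul, Nat.cast_pow]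
  abel

/-- [folklore] **THE SECOND-ORDER WARD IDENTITY, W-Hessian type, exact form in the SECOND slot** (by slot exchange). -/
theorem skewHess_grad_right (X : Form1 d A) (lam : (Fin d → ℤ) → A) (L : ℕ) (μ : Fin d) (y : Fin d → ℤ) :
    skewHess β X (grad lam) L μ y
      = -(linAvg (midF β.flip lam X) L μ y
          - β.flip (lam ((L : ℤ) • y) + lam ((L : ℤ) • y + (L : ℤ) • unitVec μ)) (linAvg X L μ y)) := by
  rw [skewHess_swap β, skewHess_grad_left]

/-- [folklore] **THE SECOND-ORDER WARD IDENTITY, product-chart type, exact form in the FIRST slot**: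
`skewVH β (grad λ) B = 2L^d • (Z (endF β λ B) − β (λ(c₊)) (Z B))` — only the FORWARD endpoints survive
(`midF + ptF β (grad λ) · = 2•endF` pointwise) and only the conjugation at `c₊`. -/
theorem skewVH_grad_left (lam : (Fin d → ℤ) → A) (B : Form1 d A) (L : ℕ) (μ : Fin d) (y : Fin d → ℤ) :
    skewVH β (grad lam) B L μ y
      = (2 * (L : ℤ) ^ d) • (linAvg (endF β lam B) L μ y - β (lam ((L : ℤ) • y + (L : ℤ) • unitVec μ)) (linAvg B L μ y)) := by
  have hcard : (box d L).card = L ^ d := by simp [AffineAveraging.box, Fintype.card_piFinset]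
  have hform : ptF β (grad lam) B = endF β lam B + endF β lam B - midF β lam B := by
    funext κ x
    simp only [ptF_apply, endF_apply, midF_apply, grad, Pi.add_apply, Pi.sub_apply, map_add, map_sub,
      AddMonoidHom.add_apply, AddMonoidHom.sub_apply]
    abel
  rw [skewVH, skewHess_grad_left, hform, linAvg_subForm, linAvg_addForm, linAvg_grad, hcard]
  simp only [map_add, map_sub, map_zsmul, AddMonoidHom.add_apply, AddMonoidHom.sub_apply, AddMonoidHom.zsmul_apply,
    smul_add, smul_sub, ← natCast_zsmul, Nat.cast_pow, mul_smul, two_zsmul]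
  abel

/-- [folklore] **THE SECOND-ORDER WARD IDENTITY, product-chart type, exact form in the SECOND slot**:
`skewVH β X (grad λ) = 2L^d • (β (Z X) (λ(c₋)) − Z (iniF β X λ))` — only the INITIAL endpoints survive and only the
conjugation at `c₋`. -/
theorem skewVH_grad_right (X : Form1 d A) (lam : (Fin d → ℤ) → A) (L : ℕ) (μ : Fin d) (y : Fin d → ℤ) :
    skewVH β X (grad lam) L μ y
      = (2 * (L : ℤ) ^ d) • (β (linAvg X L μ y) (lam ((L : ℤ) • y)) - linAvg (iniF β X lam) L μ y) := by
  have hcard : (box d L).card = L ^ d := by simp [AffineAveraging.box, Fintype.card_piFinset]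
  have hform : ptF β X (grad lam) = midF β.flip lam X - (iniF β X lam + iniF β X lam) := by
    funext κ x
    simp only [ptF_apply, iniF_apply, midF_apply, grad, Pi.add_apply, Pi.sub_apply, map_add, map_sub,
      AddMonoidHom.add_apply, AddMonoidHom.flip_apply]
    abel
  rw [skewVH, skewHess_grad_right, hform, linAvg_subForm, linAvg_addForm, linAvg_grad, hcard]
  simp only [map_add, map_sub, map_zsmul, AddMonoidHom.add_apply, AddMonoidHom.flip_apply, smul_add, smul_sub,
    neg_sub, ← natCast_zsmul, Nat.cast_pow, mul_smul, two_zsmul]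
  abel

end Functional

/-! ## §4 ALGEBRA FLAVOUR (`β = [·,·]`): the Ward identities of node 7a's `hessU` and `vhU` -/

section Algebra

variable {d : ℕ} {𝔸 : Type*} [Ring 𝔸]

/-- [folklore] The commutator as a biadditive pairing `𝔸 →+ 𝔸 →+ 𝔸`. -/
def commBi : 𝔸 →+ 𝔸 →+ 𝔸 := AddMonoidHom.mul - (AddMonoidHom.mul : 𝔸 →+ 𝔸 →+ 𝔸).flip

/-- [folklore] `commBi a b = [a, b]` (node 7a's `comm`). -/
@[simp] theorem commBi_apply (a b : 𝔸) : commBi a b = comm a b := by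
  simp [commBi, AveragingHessianKernels.comm, AddMonoidHom.sub_apply]

/-- [folklore] `commBi.flip = −commBi`. -/
theorem commBi_flip : (commBi : 𝔸 →+ 𝔸 →+ 𝔸).flip = -commBi := by
  ext a b
  simp [comm_anticomm a b]

/-- [folklore] BRIDGE: node 7a's polarised commutator sum is the skew pairing sum of the commutator. -/
theorem cross_eq_skew (l : List (𝔸 × 𝔸)) : cross l = skew commBi l := by
  induction l with
  | nil => rfl
  | cons p l ih => rw [cross_cons, skew_cons, ih, commBi_apply, commBi_apply, comm_anticomm (bg l).sum p.2, sub_eq_add_neg]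

/-- [folklore] BRIDGE: `hessU = skewHess [·,·]`. -/
theorem hessU_eq_skewHess (W W' : Form1 d 𝔸) (L : ℕ) (μ : Fin d) (y : Fin d → ℤ) :
    hessU W W' L μ y = skewHess commBi W W' L μ y := by
  simp only [hessU, skewHess, cross_eq_skew, commBi_apply]
  rw [comm_anticomm (linAvg W' L μ y) (segUp W ((L : ℤ) • y) μ L).sum, sub_neg_eq_add]

/-- [folklore] `bw = ptF [·,·]`. -/
theorem bw_eq_ptF (W B : Form1 d 𝔸) : bw W B = ptF commBi W B := by
  funext κ x; simp

/-- [folklore] BRIDGE: `vhU = skewVH [·,·]`. -/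
theorem vhU_eq_skewVH (W B : Form1 d 𝔸) (L : ℕ) (μ : Fin d) (y : Fin d → ℤ) :
    vhU W B L μ y = skewVH commBi W B L μ y := by
  simp only [vhU, skewVH, hessU_eq_skewHess, bw_eq_ptF, commBi_apply]

/-- [folklore] The one-form `x ↦ [λ(x) + λ(x + e_κ), B_κ(x)]`. -/
def midC (lam : (Fin d → ℤ) → 𝔸) (B : Form1 d 𝔸) : Form1 d 𝔸 := fun κ x => comm (lam x + lam (x + unitVec κ)) (B κ x)

/-- [folklore] The one-form `x ↦ [λ(x + e_κ), B_κ(x)]` (gauge function at the FORWARD endpoint). -/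
def endC (lam : (Fin d → ℤ) → 𝔸) (B : Form1 d 𝔸) : Form1 d 𝔸 := fun κ x => comm (lam (x + unitVec κ)) (B κ x)

/-- [folklore] The one-form `x ↦ [λ(x), W_κ(x)]` (gauge function at the INITIAL endpoint). -/
def iniC (lam : (Fin d → ℤ) → 𝔸) (W : Form1 d 𝔸) : Form1 d 𝔸 := fun κ x => comm (lam x) (W κ x)

/-- [folklore] Evaluation of `midC`. -/
@[simp] theorem midC_apply (lam : (Fin d → ℤ) → 𝔸) (B : Form1 d 𝔸) (κ : Fin d) (x : Fin d → ℤ) :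
    midC lam B κ x = comm (lam x + lam (x + unitVec κ)) (B κ x) := rfl

/-- [folklore] Evaluation of `endC`. -/
@[simp] theorem endC_apply (lam : (Fin d → ℤ) → 𝔸) (B : Form1 d 𝔸) (κ : Fin d) (x : Fin d → ℤ) :
    endC lam B κ x = comm (lam (x + unitVec κ)) (B κ x) := rfl

/-- [folklore] Evaluation of `iniC`. -/
@[simp] theorem iniC_apply (lam : (Fin d → ℤ) → 𝔸) (W : Form1 d 𝔸) (κ : Fin d) (x : Fin d → ℤ) :
    iniC lam W κ x = comm (lam x) (W κ x) := rfl

/-- [folklore] **(W-H1) SECOND-ORDER WARD IDENTITY OF THE W-HESSIAN FUNCTIONAL, exact fluctuation**: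
`hessU (grad λ) B = Z [λ(·) + λ(· + e), B] − [λ(c₋) + λ(c₊), Z B]`.  Letter-level reading (node 7b THEOREM H makes
`hessU/(2L^d)` the polarised second jet of any local log of `Φ_b` at `U = 1`): along the ray `e^{s·dλ + s′B}` the
mixed `ss′`-jet of `log Φ_b` is the BCH pairing of `B` with `λ` at the two ends of each bond, minus the coarse
conjugation `[λ(c₋) + λ(c₊), ·]/2` of the first jet — the infinitesimal form of B7 (11) «Ū^u = (Ū)^u» one order up. -/
theorem hessU_grad_left (lam : (Fin d → ℤ) → 𝔸) (B : Form1 d 𝔸) (L : ℕ) (μ : Fin d) (y : Fin d → ℤ) :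
    hessU (grad lam) B L μ y
      = linAvg (midC lam B) L μ y - comm (lam ((L : ℤ) • y) + lam ((L : ℤ) • y + (L : ℤ) • unitVec μ)) (linAvg B L μ y) := by
  have h : midF commBi lam B = midC lam B := by
    funext κ x; simp only [midF_apply, midC_apply, commBi_apply]
  rw [hessU_eq_skewHess, skewHess_grad_left, h, commBi_apply]

/-- [folklore] **(W-H2)** the same with the exact form in the SECOND slot (node 7a `hessU_symm`). -/
theorem hessU_grad_right (W : Form1 d 𝔸) (lam : (Fin d → ℤ) → 𝔸) (L : ℕ) (μ : Fin d) (y : Fin d → ℤ) :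
    hessU W (grad lam) L μ y
      = linAvg (midC lam W) L μ y - comm (lam ((L : ℤ) • y) + lam ((L : ℤ) • y + (L : ℤ) • unitVec μ)) (linAvg W L μ y) := by
  rw [← hessU_symm, hessU_grad_left]

/-- [folklore] **(W-V1) SECOND-ORDER WARD IDENTITY OF THE PRODUCT-CHART FUNCTIONAL, exact FLUCTUATION**:
`vhU (grad λ) B = 2L^d • (Z [λ(· + e), B] − [λ(c₊), Z B])`.  Letter-level reading (node 7b THEOREM B: `vhU/(2L^{2d})`
is `∂_s∂_t|₀ log[Φ_b(e^{sW}e^{tB})Φ_b(e^{tB})⁻¹]`): with `W = dλ` only the FORWARD endpoints and the conjugation at `c₊`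
survive, because `e^{s·dλ}` on the LEFT of `e^{tB}` is, to first order in `s`, the gauge transformation
`e^{−sλ}` acting on `e^{tB}` up to the re-centring that B9 (3.12) puts on the left. -/
theorem vhU_grad_left (lam : (Fin d → ℤ) → 𝔸) (B : Form1 d 𝔸) (L : ℕ) (μ : Fin d) (y : Fin d → ℤ) :
    vhU (grad lam) B L μ y
      = (2 * (L : ℤ) ^ d) • (linAvg (endC lam B) L μ y - comm (lam ((L : ℤ) • y + (L : ℤ) • unitVec μ)) (linAvg B L μ y)) := by
  have h : endF commBi lam B = endC lam B := by
    funext κ x; simp only [endF_apply, endC_apply, commBi_apply]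
  rw [vhU_eq_skewVH, skewVH_grad_left, h, commBi_apply]

/-- [folklore] **(W-V2) SECOND-ORDER WARD IDENTITY OF THE PRODUCT-CHART FUNCTIONAL, exact BACKGROUND**:
`vhU W (grad λ) = 2L^d • (Z [λ(·), W] − [λ(c₋), Z W])` — the background gauge variation `B ↦ B + t·dλ` seen by the
fluctuation in the product chart `e^{sW}e^{tB}`: only the INITIAL endpoints and the conjugation at `c₋` survive
(`e^{sW_x}·g_x e^{B} g_{x+e}⁻¹ = g_x (e^{s·Ad(g_x⁻¹)W_x} e^{B}) g_{x+e}⁻¹`: the fluctuation letter is rotated at the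
bond's initial point, the coarse datum conjugated at `c₋`). This is the an1 letter-level analogue, ONE ORDER UP, of
the contact term `X y ∘ V − V ∘ X y` of an2's `KernelWard` (W2). -/
theorem vhU_grad_right (W : Form1 d 𝔸) (lam : (Fin d → ℤ) → 𝔸) (L : ℕ) (μ : Fin d) (y : Fin d → ℤ) :
    vhU W (grad lam) L μ y
      = (2 * (L : ℤ) ^ d) • (linAvg (iniC lam W) L μ y - comm (lam ((L : ℤ) • y)) (linAvg W L μ y)) := by
  have h : iniF commBi W lam = -iniC lam W := by
    funext κ x
    simp only [iniF_apply, Pi.neg_apply, iniC_apply, commBi_apply, comm_anticomm (lam x) (W κ x)]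
  have hneg : linAvg (-iniC lam W) L μ y = -linAvg (iniC lam W) L μ y := by
    have := linAvg_subForm (0 : Form1 d 𝔸) (iniC lam W) L μ y
    rwa [zero_sub, linAvg_zeroForm, zero_sub] at this
  rw [vhU_eq_skewVH, skewVH_grad_right, h, hneg, commBi_apply, comm_anticomm (lam ((L : ℤ) • y)) (linAvg W L μ y)]
  abel

end Algebra

/-! ## §5 KERNEL FLAVOUR (`β = (·*·)` on `ℤ`): backward-divergence laws of node 7a's `hessCount` and `vhCount` -/

section Kernel

variable {d : ℕ}

/-- [folklore] The product pairing on `ℤ`. -/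
abbrev mulZ : ℤ →+ ℤ →+ ℤ := AddMonoidHom.mul

/-- [folklore] BRIDGE: node 7a's wedge count is the skew pairing sum of the product (any commutative ring). -/
theorem wedge_eq_skew {R : Type*} [CommRing R] (l : List (R × R)) : wedge l = skew (AddMonoidHom.mul : R →+ R →+ R) l := by
  induction l with
  | nil => rfl
  | cons p l ih => rw [wedge_cons, skew_cons, ih, AddMonoidHom.mul_apply, AddMonoidHom.mul_apply, mul_comm (bg l).sum p.2]

/-- [folklore] BRIDGE: `hessCount f f′ = skewHess (·*·) δ_f δ_{f′}`. -/
theorem hessCount_eq_skewHess (L : ℕ) (μ : Fin d) (y : Fin d → ℤ) (f f' : Bond d) :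
    hessCount L μ y f f' = skewHess mulZ (δ1 f) (δ1 f') L μ y := by
  simp only [hessCount, skewHess, linCount, cCount, wedge_eq_skew, mulZ, AddMonoidHom.mul_apply, smul_eq_mul]
  ring

/-- [folklore] The pointwise product of two bond indicators. -/
theorem ptF_mulZ_δ1 (f f' : Bond d) : ptF mulZ (δ1 f) (δ1 f') = if f = f' then δ1 f else 0 := by
  funext κ x
  simp only [ptF_apply, δ1_apply, AddMonoidHom.mul_apply]
  by_cases h : (κ, x) = f
  · by_cases h' : (κ, x) = f'
    · have : f = f' := h.symm.trans h'
      simp [h, this]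
    · have : f ≠ f' := fun e => h' (h.trans e)
      simp [h, this]
  · by_cases hff : f = f'
    · subst hff; simp [h]
    · simp [h, hff]

/-- [folklore] BRIDGE: `vhCount f f′ = skewVH (·*·) δ_f δ_{f′}`. -/
theorem vhCount_eq_skewVH (L : ℕ) (μ : Fin d) (y : Fin d → ℤ) (f f' : Bond d) :
    vhCount L μ y f f' = skewVH mulZ (δ1 f) (δ1 f') L μ y := by
  have hpt : linAvg (ptF mulZ (δ1 f) (δ1 f')) L μ y = if f = f' then linCount L μ y f else 0 := by
    rw [ptF_mulZ_δ1]
    split_ifs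
    · rfl
    · exact linAvg_zeroForm L μ y
  simp only [vhCount, skewVH, hessCount_eq_skewHess, hpt, linCount, AddMonoidHom.mul_apply, smul_eq_mul]

/-- [folklore] The SITE INDICATOR gauge function `δ_z`. -/
def siteδ (z : Fin d → ℤ) : (Fin d → ℤ) → ℤ := fun x => if x = z then 1 else 0

/-- [folklore] Evaluation of `siteδ`. -/
@[simp] theorem siteδ_apply (z x : Fin d → ℤ) : siteδ z x = if x = z then 1 else 0 := rfl

/-- [folklore] THE PURE-GAUGE BACKGROUND VARIATION at the fine site `z`: `d(δ_z) = Σ_κ (δ_{(κ, z − e_κ)} − δ_{(κ, z)})`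
(an2's `KernelWard.divV` convention, backward divergence in the bond's base point). -/
theorem grad_siteδ (z : Fin d → ℤ) :
    grad (siteδ z) = ∑ κ : Fin d, (δ1 (κ, z - unitVec κ) - δ1 (κ, z)) := by
  funext κ x
  rw [Finset.sum_apply, Finset.sum_apply, Finset.sum_eq_single κ]
  · simp only [grad, siteδ_apply, Pi.sub_apply, δ1_apply, Prod.mk.injEq, true_and, eq_sub_iff_add_eq]
  · intro κ' _ hne
    simp [Pi.sub_apply, δ1_apply, Prod.mk.injEq, Ne.symm hne]
  · intro h; exact absurd (Finset.mem_univ κ) h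

/-- [folklore] `midF (·*·) δ_z δ_{f′}` is supported on `f′` with value `[f′₋ = z] + [f′₊ = z]`. -/
theorem midF_mulZ_siteδ (z : Fin d → ℤ) (f' : Bond d) :
    midF mulZ (siteδ z) (δ1 f')
      = single f' ((if f'.2 = z then 1 else 0) + (if f'.2 + unitVec f'.1 = z then 1 else 0)) := by
  funext κ x
  simp only [midF_apply, siteδ_apply, δ1_apply, single_apply, AddMonoidHom.mul_apply]
  by_cases h : (κ, x) = f'
  · subst h; simp
  · simp [h]

/-- [folklore] `endF (·*·) δ_z δ_{f′}` is supported on `f′` with value `[f′₊ = z]`. -/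
theorem endF_mulZ_siteδ (z : Fin d → ℤ) (f' : Bond d) :
    endF mulZ (siteδ z) (δ1 f') = single f' (if f'.2 + unitVec f'.1 = z then 1 else 0) := by
  funext κ x
  simp only [endF_apply, siteδ_apply, δ1_apply, single_apply, AddMonoidHom.mul_apply]
  by_cases h : (κ, x) = f'
  · subst h; simp
  · simp [h]

/-- [folklore] `iniF (·*·) δ_f δ_z` is supported on `f` with value `[f₋ = z]`. -/
theorem iniF_mulZ_siteδ (f : Bond d) (z : Fin d → ℤ) :
    iniF mulZ (δ1 f) (siteδ z) = single f (if f.2 = z then 1 else 0) := by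
  funext κ x
  simp only [iniF_apply, siteδ_apply, δ1_apply, single_apply, AddMonoidHom.mul_apply]
  by_cases h : (κ, x) = f
  · subst h; simp
  · simp [h]

/-- [folklore] **(K-H) BACKWARD-DIVERGENCE LAW OF THE W-HESSIAN KERNEL in its first bond**: for every fine site `z`,
`Σ_κ (hessCount (κ, z − e_κ) f′ − hessCount (κ, z) f′) = ([f′₋ = z] + [f′₊ = z] − [c₋ = z] − [c₊ = z]) · linCount f′`
(`f′₋ = f′.2`, `f′₊ = f′.2 + e_{f′.1}`, `c₋ = L·y`, `c₊ = L·y + L·e_μ`).  So `h_b = hessCount/(2L^d)` is NOT transversal: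
its divergence is the explicit CONTACT TERM — the first-jet kernel `q¹_b(f′)` weighted by the incidence of `z` with the
endpoints of `f′` and of the coarse bond (the an1 analogue of an2 `KernelWard` (W2)'s `X y ∘ V − V ∘ X y`). -/
theorem hessCount_div_left (L : ℕ) (μ : Fin d) (y : Fin d → ℤ) (z : Fin d → ℤ) (f' : Bond d) :
    ∑ κ : Fin d, (hessCount L μ y (κ, z - unitVec κ) f' - hessCount L μ y (κ, z) f')
      = ((if f'.2 = z then 1 else 0) + (if f'.2 + unitVec f'.1 = z then 1 else 0)
          - (if (L : ℤ) • y = z then 1 else 0) - (if (L : ℤ) • y + (L : ℤ) • unitVec μ = z then 1 else 0))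
        * linCount L μ y f' := by
  simp only [hessCount_eq_skewHess, ← skewHess_sub_left, ← skewHess_sum_left, ← grad_siteδ, skewHess_grad_left,
    midF_mulZ_siteδ, linAvg_single, siteδ_apply, AddMonoidHom.mul_apply, smul_eq_mul]
  rw [show linAvg (δ1 f') L μ y = linCount L μ y f' from rfl]
  ring

/-- [folklore] **(K-H′) … in its second bond** (antisymmetry `hessCount_swap`). -/
theorem hessCount_div_right (L : ℕ) (μ : Fin d) (y : Fin d → ℤ) (f : Bond d) (z : Fin d → ℤ) :
    ∑ κ : Fin d, (hessCount L μ y f (κ, z - unitVec κ) - hessCount L μ y f (κ, z))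
      = -(((if f.2 = z then 1 else 0) + (if f.2 + unitVec f.1 = z then 1 else 0)
          - (if (L : ℤ) • y = z then 1 else 0) - (if (L : ℤ) • y + (L : ℤ) • unitVec μ = z then 1 else 0))
        * linCount L μ y f) := by
  rw [← hessCount_div_left, ← Finset.sum_neg_distrib]
  refine Finset.sum_congr rfl fun κ _ => ?_
  rw [hessCount_swap L μ y f (κ, z - unitVec κ), hessCount_swap L μ y f (κ, z)]
  ring

/-- [folklore] **(K-V1) BACKWARD-DIVERGENCE LAW OF THE PRODUCT-CHART KERNEL in its FLUCTUATION bond**: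
`Σ_κ (vhCount (κ, z − e_κ) f′ − vhCount (κ, z) f′) = 2L^d · ([f′₊ = z] − [c₊ = z]) · linCount f′`. -/
theorem vhCount_div_left (L : ℕ) (μ : Fin d) (y : Fin d → ℤ) (z : Fin d → ℤ) (f' : Bond d) :
    ∑ κ : Fin d, (vhCount L μ y (κ, z - unitVec κ) f' - vhCount L μ y (κ, z) f')
      = 2 * (L : ℤ) ^ d
        * (((if f'.2 + unitVec f'.1 = z then 1 else 0) - (if (L : ℤ) • y + (L : ℤ) • unitVec μ = z then 1 else 0))
          * linCount L μ y f') := by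
  simp only [vhCount_eq_skewVH, ← skewVH_sub_left, ← skewVH_sum_left, ← grad_siteδ, skewVH_grad_left,
    endF_mulZ_siteδ, linAvg_single, siteδ_apply, AddMonoidHom.mul_apply, smul_eq_mul]
  rw [show linAvg (δ1 f') L μ y = linCount L μ y f' from rfl]
  ring

/-- [folklore] **(K-V2) BACKWARD-DIVERGENCE LAW OF THE PRODUCT-CHART KERNEL in its BACKGROUND bond**:
`Σ_κ (vhCount f (κ, z − e_κ) − vhCount f (κ, z)) = 2L^d · ([c₋ = z] − [f₋ = z]) · linCount f` (sign: the kernel is the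
coefficient of `[W_f, B_{f′}]` with the fluctuation letter FIRST). -/
theorem vhCount_div_right (L : ℕ) (μ : Fin d) (y : Fin d → ℤ) (f : Bond d) (z : Fin d → ℤ) :
    ∑ κ : Fin d, (vhCount L μ y f (κ, z - unitVec κ) - vhCount L μ y f (κ, z))
      = 2 * (L : ℤ) ^ d * (((if (L : ℤ) • y = z then 1 else 0) - (if f.2 = z then 1 else 0)) * linCount L μ y f) := by
  simp only [vhCount_eq_skewVH, ← skewVH_sub_right, ← skewVH_sum_right, ← grad_siteδ, skewVH_grad_right,
    iniF_mulZ_siteδ, linAvg_single, siteδ_apply, AddMonoidHom.mul_apply, smul_eq_mul]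
  rw [show linAvg (δ1 f) L μ y = linCount L μ y f from rfl]
  ring

/-- [folklore] (K-H) for the REAL kernel `h_b = hessCount/(2L^d)`: divergence `= (contact indicator) · q¹_b(f′)/2`. -/
theorem hessKer_div_left {L : ℕ} (hL : 1 ≤ L) (μ : Fin d) (y : Fin d → ℤ) (z : Fin d → ℤ) (f' : Bond d) :
    ∑ κ : Fin d, (hessKer L μ y (κ, z - unitVec κ) f' - hessKer L μ y (κ, z) f')
      = ((if f'.2 = z then 1 else 0) + (if f'.2 + unitVec f'.1 = z then 1 else 0)
          - (if (L : ℤ) • y = z then 1 else 0) - (if (L : ℤ) • y + (L : ℤ) • unitVec μ = z then 1 else 0))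
        * linKer L μ y f' / 2 := by
  have hL' : (L : ℝ) ≠ 0 := by exact_mod_cast (show L ≠ 0 by omega)
  simp only [hessKer, linKer, ← sub_div, ← Finset.sum_div, ← Int.cast_sub, ← Int.cast_sum, hessCount_div_left]
  push_cast
  field_simp

/-- [folklore] (K-V1) for the REAL kernel `m_b = vhCount/(2L^{2d})`: divergence in the fluctuation bond
`= ([f′₊ = z] − [c₊ = z]) · q¹_b(f′)`. -/
theorem vhKer_div_left {L : ℕ} (hL : 1 ≤ L) (μ : Fin d) (y : Fin d → ℤ) (z : Fin d → ℤ) (f' : Bond d) :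
    ∑ κ : Fin d, (vhKer L μ y (κ, z - unitVec κ) f' - vhKer L μ y (κ, z) f')
      = ((if f'.2 + unitVec f'.1 = z then 1 else 0) - (if (L : ℤ) • y + (L : ℤ) • unitVec μ = z then 1 else 0))
        * linKer L μ y f' := by
  have hL' : (L : ℝ) ≠ 0 := by exact_mod_cast (show L ≠ 0 by omega)
  simp only [vhKer, linKer, ← sub_div, ← Finset.sum_div, ← Int.cast_sub, ← Int.cast_sum, vhCount_div_left]
  push_cast
  field_simp
  ring

/-- [folklore] (K-V2) for the REAL kernel: divergence in the background bond `= ([c₋ = z] − [f₋ = z]) · q¹_b(f)`. -/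
theorem vhKer_div_right {L : ℕ} (hL : 1 ≤ L) (μ : Fin d) (y : Fin d → ℤ) (f : Bond d) (z : Fin d → ℤ) :
    ∑ κ : Fin d, (vhKer L μ y f (κ, z - unitVec κ) - vhKer L μ y f (κ, z))
      = ((if (L : ℤ) • y = z then 1 else 0) - (if f.2 = z then 1 else 0)) * linKer L μ y f := by
  have hL' : (L : ℝ) ≠ 0 := by exact_mod_cast (show L ≠ 0 by omega)
  simp only [vhKer, linKer, ← sub_div, ← Finset.sum_div, ← Int.cast_sub, ← Int.cast_sum, vhCount_div_right]
  push_cast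
  field_simp
  ring

end Kernel

/-! ## §6 DECIDED toy checks (`d = 1`, `L = 2`, `b = (0, 0)`: `c₋ = 0`, `c₊ = 2`; node 7a §11 tables
`hessCount(c₀,c₁) = 2 = −hessCount(c₁,c₀)`, `vhCount(c₁,c₀) = −8`, `linCount(c₀) = linCount(c₁) = 2`) -/

section Toy

/-- (K-H) at `z = 1`, `f′ = c₁`: `hessCount(c₀,c₁) − hessCount(c₁,c₁) = 2 = ([1=1] + [2=1] − [0=1] − [2=1])·2`. -/
example : ∑ κ : Fin 1, (hessCount 2 0 (fun _ => 0) (κ, (fun _ => (1 : ℤ)) - unitVec κ) (0, fun _ => 1)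
    - hessCount 2 0 (fun _ => 0) (κ, fun _ => 1) (0, fun _ => 1)) = 2 := by decide

/-- (K-H) at `z = 2`, `f′ = c₀`: `hessCount(c₁,c₀) − hessCount((0,2),c₀) = −2 = (0 + 0 − 0 − [2=2])·2`. -/
example : ∑ κ : Fin 1, (hessCount 2 0 (fun _ => 0) (κ, (fun _ => (2 : ℤ)) - unitVec κ) (0, fun _ => 0)
    - hessCount 2 0 (fun _ => 0) (κ, fun _ => 2) (0, fun _ => 0)) = -2 := by decide

/-- (K-V1) at `z = 1`, `f′ = c₀`: `vhCount(c₀,c₀) − vhCount(c₁,c₀) = 8 = 2·2·([1=1] − [2=1])·2`. -/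
example : ∑ κ : Fin 1, (vhCount 2 0 (fun _ => 0) (κ, (fun _ => (1 : ℤ)) - unitVec κ) (0, fun _ => 0)
    - vhCount 2 0 (fun _ => 0) (κ, fun _ => 1) (0, fun _ => 0)) = 8 := by decide

/-- (K-V2) at `z = 1`, `f = c₁`: `vhCount(c₁,c₀) − vhCount(c₁,c₁) = −8 = 2·2·([0=1] − [1=1])·2` (the sign of (K-V2)). -/
example : ∑ κ : Fin 1, (vhCount 2 0 (fun _ => 0) (0, fun _ => 1) (κ, (fun _ => (1 : ℤ)) - unitVec κ)
    - vhCount 2 0 (fun _ => 0) (0, fun _ => 1) (κ, fun _ => 1)) = -8 := by decide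

end Toy


end Literature.MathematicalPhysics.QuantumFieldTheory.Balaban1983to89.Beta.AveragingWardJets
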